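import Mathlib
import Summits.NavierStokesRegularity.NavierStokesRegularity.Theses.SwirlStarvation
import Summits.NavierStokesRegularity.NavierStokesRegularity.Theorems.TypeICertificateLadderTargetTypeIZoomPhysical
import Literature.Analysis.FluidPDE.KNSSLocalSmoothingHolds
import Literature.Analysis.FluidPDE.SpaceTimeCalculusC1
import HarnessLib

/-!
# `SwirlStarvation.SmoothingExcess` — the parabolic smoothing bound `ν‖ω(t)‖_∞ ≤ C_S M²`
  (route `SwirlStarvation`, item stmt-NavierStokesRegularity-13888, support; card fact (S))

**Statement.** There is an absolute `C_S > 0` such that for every classical solution `(u, p)` of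
the unforced Navier–Stokes system (`ν > 0`) on `ℝ³ × [0, T)`, Leray–Hopf from its rapidly decaying
datum: if `0 ≤ t₀ < t < T`, `ν ≤ M² (t − t₀)` and `‖u‖ ≤ M` on `[t₀, t] × ℝ³`, then
`ν‖curl u(t, x)‖ ≤ C_S M²` for all `x`. (General data, no symmetry.)

PROOF (Koch–Nadirashvili–Seregin–Šverák 2009, Prop. 4.1, `k = 1`, `l = 0`: parabolic smoothing of
bounded mild solutions, as discharged in the tree by `knss2009_local_smoothing_holds` with absolute
constants `ε, C`). Restart at `s = t − κ₀ν/M²`, `κ₀ = min(ε/2, 1/2)`: then `t₀ ≤ s`, `0 < s < t`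
and `t < s + εν/M²`; on `(s, t)` the classical solution solves the Oseen integral equation from
`u(s)` pointwise (`typeIZoom_oseen_pairs`) and is bounded by `M`, so it coincides there with the
smooth local solution `v` from `u(s)` (`exists_local_smooth_representative`, uniqueness of bounded
solutions), whose gradient obeys `√(ν(τ − s))‖∇v(τ, x)‖ ≤ C M`. Letting `τ ↑ t` (joint continuity
of `∇u`, `continuousOn_fderiv_slice_of_contDiffOn`) gives `‖∇u(t, x)‖ ≤ C M²/(ν√κ₀)`, and
`‖curl u‖ ≤ 4‖∇u‖` (`norm_curl_le_four_mul`); `C_S = 4C/√κ₀ + 1`.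

HONEST FRAMING: an a-priori smoothing estimate for a HYPOTHETICAL classical solution; nothing here
bears on the regularity problem itself.
-/

noncomputable section

set_option linter.dupNamespace false

namespace Summit.NavierStokesRegularity.NavierStokesRegularity.Theorems

open MeasureTheory Set Filter Topology Function Metric
open scoped RealInnerProductSpace NNReal ENNReal
open Literature.Analysis Literature.Analysis.FluidPDE

/-- **Item stmt-NavierStokesRegularity-13888** (`SwirlStarvation.SmoothingExcess`; KNSS 2009
Prop. 4.1 with `k = 1`): an absolute `C_S > 0` with `ν‖curl u(t,x)‖ ≤ C_S M²` whenever a classical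
Leray–Hopf solution from a rapidly decaying datum is bounded by `M` on `[t₀, t] × ℝ³` with
`ν ≤ M²(t − t₀)`. [this file; KochNadirashviliSereginSverak2009 Prop. 4.1] -/
theorem swirlStarvation_smoothingExcess_proof :
    Summit.NavierStokesRegularity.NavierStokesRegularity.Theses.SwirlStarvation.SmoothingExcess := by
  unfold Summit.NavierStokesRegularity.NavierStokesRegularity.Theses.SwirlStarvation.SmoothingExcess
  haveI : Nontrivial (EuclideanSpace ℝ (Fin 3)) := inferInstance
  -- the local smoothing constants for `k = 1`, `l = 0`
  obtain ⟨ε, hε, Cs, hCs, hL⟩ := knss2009_local_smoothing_holds (EuclideanSpace ℝ (Fin 3)) 1 0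
  set κ₀ : ℝ := min (ε / 2) (1 / 2) with hκ₀
  have hκ₀pos : 0 < κ₀ := lt_min (by positivity) (by norm_num)
  have hκ₀half : κ₀ ≤ 1 / 2 := min_le_right _ _
  have hκ₀ε : κ₀ < ε := lt_of_le_of_lt (min_le_left _ _) (by linarith)
  have hsqκ : 0 < Real.sqrt κ₀ := Real.sqrt_pos.2 hκ₀pos
  refine ⟨4 * Cs / Real.sqrt κ₀ + 1, by positivity, ?_⟩
  intro ν T hν hT u p hcl hLH hdec M t₀ t ht₀ ht₀t htT hνM hbd x
  -- `M > 0`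
  have hMpos : 0 < M := by
    by_contra h
    push Not at h
    rcases h.eq_or_lt with h0 | hneg
    · rw [h0] at hνM
      simp at hνM
      linarith
    · have h1 := hbd t₀ ⟨le_rfl, ht₀t.le⟩ 0
      linarith [norm_nonneg (u t₀ 0)]
  have hM2 : 0 < M ^ 2 := by positivity
  -- ### continuity and measurability of the classical solution
  have hcont : ContinuousOn (uncurry u) (Ico 0 T ×ˢ univ) := hcl.smooth_velocity.continuousOn
  have hslice : ∀ τ ∈ Ico 0 T, Continuous (u τ) := fun τ hτ =>
    hcont.comp_continuous (Continuous.prodMk_right τ) fun y => ⟨hτ, mem_univ y⟩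
  have hmeasIoo : ∀ a b : ℝ, 0 ≤ a → b ≤ T → AEStronglyMeasurable (uncurry u)
      ((volume : Measure (ℝ × EuclideanSpace ℝ (Fin 3))).restrict (Ioo a b ×ˢ univ)) :=
    fun a b ha hb => (hcont.mono (prod_mono (fun τ hτ => ⟨ha.trans hτ.1.le, hτ.2.trans_le hb⟩)
      Subset.rfl)).aestronglyMeasurable (measurableSet_Ioo.prod MeasurableSet.univ)
  -- ### the window `(s, t)`, `s = t − κ₀ ν / M²`
  set s : ℝ := t - κ₀ * ν / M ^ 2 with hs
  have hνM' : ν / M ^ 2 ≤ t - t₀ := by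
    rw [div_le_iff₀ hM2]; linarith
  have hd0 : 0 < κ₀ * ν / M ^ 2 := by positivity
  have hst : s < t := by rw [hs]; linarith
  have hts : t - s = κ₀ * ν / M ^ 2 := by rw [hs]; ring
  have hd1 : κ₀ * ν / M ^ 2 ≤ (1 / 2) * (t - t₀) := by
    calc κ₀ * ν / M ^ 2 = κ₀ * (ν / M ^ 2) := by ring
      _ ≤ (1 / 2) * (t - t₀) := mul_le_mul hκ₀half hνM' (by positivity) (by norm_num)
  have ht₀s : t₀ ≤ s := by rw [hs]; linarith
  have hspos : 0 < s := by rw [hs]; linarith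
  have hsT : s < T := hst.trans htT
  have htwin : t < s + ε * ν / M ^ 2 := by
    have h1 : κ₀ * ν / M ^ 2 < ε * ν / M ^ 2 := by
      rw [div_lt_div_iff_of_pos_right hM2]
      exact mul_lt_mul_of_pos_right hκ₀ε hν
    linarith
  -- the bound `M` on `[s, t]`, in `L^∞` form
  have hMbd : ∀ τ, s ≤ τ → τ ≤ t → ∀ y, ‖u τ y‖ ≤ M := fun τ hsτ hτt y =>
    hbd τ ⟨ht₀s.trans hsτ, hτt⟩ y
  have hMtop : ∀ τ, s ≤ τ → τ ≤ t → eLpNorm (u τ) ∞ volume ≤ ENNReal.ofReal M := by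
    intro τ hsτ hτt
    rw [eLpNorm_exponent_top]
    exact eLpNormEssSup_le_of_ae_bound (ae_of_all _ (hMbd τ hsτ hτt))
  -- ### the smooth local representative from `u s` equals `u` on `(s, t)`
  have hoseen : ∀ τ ∈ Ioo s t, u τ =ᵐ[volume] fun y =>
      UnboundedOperators.heatExtension (u s) (ν * (τ - s)) y - oseenDuhamel ν s u u τ y :=
    fun τ hτ => Eventually.of_forall fun y =>
      typeIZoom_oseen_pairs ν T u p hν hT hcl hLH hdec s τ hspos hτ.1 (hτ.2.trans htT) y
  obtain ⟨v, -, -, hrep, -, hvbd⟩ := exists_local_smooth_representative hL hν hMpos hCs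
    ((hslice s ⟨hspos.le, hsT⟩).aestronglyMeasurable) (hMtop s le_rfl hst.le)
    (hmeasIoo s t hspos.le htT.le) (fun τ hτ => hMtop τ hτ.1.le hτ.2.le) hoseen
  -- gradient bound on `(s, t)`
  have hgrad : ∀ τ ∈ Ioo s t, ‖fderiv ℝ (u τ) x‖ ≤ Cs * M / Real.sqrt (ν * (τ - s)) := by
    intro τ hτ
    have hτw : τ ∈ Ioo s (min (s + ε * ν / M ^ 2) t) := ⟨hτ.1, lt_min (hτ.2.trans htwin) hτ.2⟩
    have huv : u τ = v τ := by
      funext y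
      rw [← hrep τ hτw y]
      exact typeIZoom_oseen_pairs ν T u p hν hT hcl hLH hdec s τ hspos hτ.1 (hτ.2.trans htT) y
    have hb := hvbd τ ⟨hτ.1, hτ.2.trans htwin⟩ x
    simp only [iteratedDeriv_zero, Nat.cast_one, pow_zero, mul_one] at hb
    rw [norm_iteratedFDeriv_one, ← Real.sqrt_eq_rpow] at hb
    have hpos : 0 < Real.sqrt (ν * (τ - s)) := Real.sqrt_pos.2 (mul_pos hν (sub_pos.2 hτ.1))
    rw [huv, le_div_iff₀ hpos, mul_comm]
    exact hb
  -- ### pass to the limit `τ ↑ t` (joint continuity of `∇u`)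
  have hc1 : ContDiffOn ℝ 1 (uncurry u) (Ico 0 T ×ˢ univ) :=
    hcl.smooth_velocity.of_le (by exact_mod_cast le_top)
  have hco := continuousOn_fderiv_slice_of_contDiffOn hc1 (uniqueDiffOn_Ico 0 T)
  have htI : t ∈ Ico 0 T := ⟨(hspos.trans hst).le, htT⟩
  have hι : ContinuousWithinAt (fun τ : ℝ => (τ, x)) (Ico 0 T) t :=
    continuousWithinAt_id.prodMk continuousWithinAt_const
  have hmaps : MapsTo (fun τ : ℝ => (τ, x)) (Ico 0 T) (Ico 0 T ×ˢ (univ : Set (EuclideanSpace ℝ (Fin 3)))) :=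
    fun τ hτ => ⟨hτ, mem_univ x⟩
  have hcw : ContinuousWithinAt (fun τ => fderiv ℝ (u τ) x) (Ico 0 T) t :=
    ContinuousWithinAt.comp (g := fun p : ℝ × EuclideanSpace ℝ (Fin 3) => fderiv ℝ (u p.1) p.2)
      (f := fun τ : ℝ => (τ, x)) (hco (t, x) ⟨htI, mem_univ x⟩) hι hmaps
  have hmem : Ico 0 T ∈ 𝓝[<] t := by
    refine mem_nhdsWithin.2 ⟨Ioo 0 T, isOpen_Ioo, ⟨hspos.trans hst, htT⟩, fun τ hτ => ?_⟩
    exact ⟨hτ.1.1.le, hτ.1.2⟩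
  have hcw' : ContinuousWithinAt (fun τ => fderiv ℝ (u τ) x) (Iio t) t :=
    hcw.mono_of_mem_nhdsWithin hmem
  have hlimf : Tendsto (fun τ => ‖fderiv ℝ (u τ) x‖) (𝓝[<] t) (𝓝 ‖fderiv ℝ (u t) x‖) :=
    hcw'.tendsto.norm
  have hlimg : Tendsto (fun τ => Cs * M / Real.sqrt (ν * (τ - s))) (𝓝[<] t)
      (𝓝 (Cs * M / Real.sqrt (ν * (t - s)))) := by
    have hcg : ContinuousAt (fun τ => Cs * M / Real.sqrt (ν * (τ - s))) t := by
      have hne : Real.sqrt (ν * (t - s)) ≠ 0 :=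
        (Real.sqrt_pos.2 (mul_pos hν (sub_pos.2 hst))).ne'
      exact continuousAt_const.div (by fun_prop) hne
    exact hcg.continuousWithinAt.tendsto
  have hev : ∀ᶠ τ in 𝓝[<] t, ‖fderiv ℝ (u τ) x‖ ≤ Cs * M / Real.sqrt (ν * (τ - s)) := by
    filter_upwards [Ioo_mem_nhdsLT hst] with τ hτ
    exact hgrad τ hτ
  have hgt : ‖fderiv ℝ (u t) x‖ ≤ Cs * M / Real.sqrt (ν * (t - s)) :=
    le_of_tendsto_of_tendsto hlimf hlimg hev
  -- ### the constant
  have hsq : Real.sqrt (ν * (t - s)) = ν * Real.sqrt κ₀ / M := by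
    have h1 : ν * (t - s) = (ν * Real.sqrt κ₀ / M) ^ 2 := by
      rw [hts, div_pow, mul_pow, Real.sq_sqrt hκ₀pos.le]
      field_simp
    rw [h1, Real.sqrt_sq (by positivity)]
  rw [hsq] at hgt
  have hq : Cs * M / (ν * Real.sqrt κ₀ / M) = Cs * M ^ 2 / (ν * Real.sqrt κ₀) := by
    field_simp
  rw [hq] at hgt
  calc ν * ‖curl (u t) x‖ ≤ ν * (4 * ‖fderiv ℝ (u t) x‖) :=
        mul_le_mul_of_nonneg_left (norm_curl_le_four_mul _ _) hν.le
    _ ≤ ν * (4 * (Cs * M ^ 2 / (ν * Real.sqrt κ₀))) := by gcongr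
    _ = 4 * Cs / Real.sqrt κ₀ * M ^ 2 := by
        field_simp
    _ ≤ (4 * Cs / Real.sqrt κ₀ + 1) * M ^ 2 := by nlinarith [hM2]

end Summit.NavierStokesRegularity.NavierStokesRegularity.Theorems

end
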